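import Mathlib
import Literature.Combinatorics.Additive.NeumannTPPSubgroupIndex
import Literature.RepresentationTheory.FiniteGroups.AbelianSubgroupDegreeBound
import Summits.MatrixMultiplication.MatrixMultiplication.Theses.GroupTheoreticSTPP
import Literature.RepresentationTheory.FiniteGroups.AbelianSubgroupIndexCharDegreeBound

/-!
# `CNonabelianTPPFamilies` as typed is false modulo a CFSG theorem (negative lemma)

Route `MatrixMultiplication/GroupTheoreticSTPP`, crux `stmt-MatrixMultiplication-0597`
(`CNonabelianTPPFamilies`): "for every `ε > 0` and `n₀` there is a finite group `G` and a TPP triple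
`S, T, U` of volume `V ≥ n₀` with `|G| ≤ V^{(2+ε)/3}` and `d_max(G) ≤ V^{ε/3}`".  The refuter's route
review (note on the item, 2026-08-15) observed that the last clause is far too strong: by the
Jordan-type theorem of Cossey–Halasi–Maróti–Nguyen 2015 (Thm. 8, via the classification of finite
simple groups) every finite group has an abelian subgroup `K` of index `≤ d_max(G)^8`, and by Neumann's
coset argument (tree `Neumann2011_cor42'`; cf. `TPPLaneObstruction.tpp_volume_le_index_sq_mul_card`)
`V ≤ [G:K]²|G| ≤ d_max^{16}|G| ≤ V^{16ε/3} V^{(2+ε)/3} = V^{(2+17ε)/3}`, impossible for `V ≥ 2` once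
`ε < 1/17`.  This file lands that observation as a NEGATIVE LEMMA `H → ¬ CNonabelianTPPFamilies`, with
`H = Literature.RepresentationTheory.FiniteGroups.CHMN2015_thm8` the cited CFSG theorem stated as a named fact (not proved in the tree); the
unconditional content (`|G|^{1−ε} ≤ [G:K]^{4+2ε}` for every abelian `K`) is
`TPPLaneObstruction.card_rpow_le_index_rpow_of_packing_exponent`.  The repaired crux `C′` (degree clause
`d_max ≤ V^{θ/3}` with a FIXED `θ < 1`, still implying `ω = 2`:
`STPPCriterion.matrixMultiplication_of_tppFamilies_theta`) is NOT touched by this argument for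
`θ ≥ (1−ε)/16`.

WHAT THIS IS NOT: not a refutation in the tree's sense (conditional on the CFSG fact `CHMN2015_thm8`);
no statement about `ω`.

## References
* J. P. Cossey, Z. Halasi, A. Maróti, H. N. Nguyen, *On a conjecture of Gluck*, Math. Z. 279 (2015)
  1067–1080, arXiv:1402.0366, Thm. 8 (p. 4 of the arXiv text): "Every finite group `G` contains an
  abelian subnormal subgroup of index at most `b(G)^8` and a solvable subgroup of index at most `b(G)^2`."
* P. M. Neumann, LMS J. Comput. Math. 14 (2011), Cor. 4.2.
-/

-- single-conjunct summit: the mandated namespace repeats `MatrixMultiplication`.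
set_option linter.dupNamespace false

noncomputable section

namespace Summit.MatrixMultiplication.MatrixMultiplication.Theorems

namespace CNonabelianTPPFamilies.Negative

open Literature.Combinatorics.Additive Literature.RepresentationTheory.FiniteGroups
  Summit.MatrixMultiplication.MatrixMultiplication.Theses.GroupTheoreticSTPP

/-- **Negative lemma: `CHMN2015_thm8 → ¬ CNonabelianTPPFamilies`.**  At `ε = 1/18`, `n₀ = 2` a witness
`(G, S, T, U)` of the crux would have, for the abelian subgroup `K` of index `≤ d_max^8 ≤ V^{8ε/3}`
supplied by CHMN Thm. 8, `V ≤ [G:K]²|G| ≤ V^{16ε/3 + (2+ε)/3} = V^{53/54} < V` (Neumann 2011, Cor. 4.2;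
`V ≥ 2`). [cite: CosseyHalasiMarotiNguyen2015, Thm. 8] [cite: Neumann2011, Cor. 4.2] -/
theorem CNonabelianTPPFamilies_false_of_CHMN2015_thm8 (hJ : Literature.RepresentationTheory.FiniteGroups.CHMN2015_thm8) :
    ¬ CNonabelianTPPFamilies := by
  intro hC
  obtain ⟨G, _, _, S, T, U, htpp, hn₀, hcard, hdeg⟩ := hC (1 / 18) (by norm_num) 2
  obtain ⟨K, hK, hidx⟩ := hJ G
  haveI := hK
  haveI : K.FiniteIndex := Subgroup.finiteIndex_of_finite
  set V : ℕ := S.card * T.card * U.card with hV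
  have hV2 : (2 : ℝ) ≤ (V : ℝ) := by exact_mod_cast hn₀
  have hV1 : (1 : ℝ) < (V : ℝ) := by linarith
  have hVpos : (0 : ℝ) < (V : ℝ) := by linarith
  have hvpos : (0 : ℝ) < K.index := by
    exact_mod_cast Nat.pos_of_ne_zero Subgroup.FiniteIndex.index_ne_zero
  -- Neumann: `V ≤ [G:K]² |G|`
  have hN : ((V : ℕ) : ℝ) ≤ (K.index : ℝ) ^ (2 : ℝ) * Fintype.card G := by
    classical
    rw [Real.rpow_two]
    exact_mod_cast Neumann2011_cor42' K htpp
  -- `[G:K] ≤ d_max^8 ≤ (V^{ε/3})^8`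
  have hidxR : (K.index : ℝ) ≤ ((V : ℝ) ^ ((1 / 18 : ℝ) / 3)) ^ (8 : ℕ) := by
    have h1 : (K.index : ℝ) ≤ (maxCharDegree G : ℝ) ^ (8 : ℕ) := by exact_mod_cast hidx
    exact h1.trans (pow_le_pow_left₀ (Nat.cast_nonneg _) hdeg 8)
  have hidx2 : (K.index : ℝ) ^ (2 : ℝ) ≤ (V : ℝ) ^ ((16 : ℝ) / 54) := by
    have h := Real.rpow_le_rpow hvpos.le hidxR (by norm_num : (0 : ℝ) ≤ 2)
    refine h.trans_eq ?_
    rw [← Real.rpow_natCast, ← Real.rpow_mul hVpos.le, ← Real.rpow_mul hVpos.le]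
    norm_num
  -- chain: `V ≤ V^{16/54} · V^{37/54} = V^{53/54}`
  have hchain : (V : ℝ) ≤ (V : ℝ) ^ ((53 : ℝ) / 54) := by
    calc (V : ℝ) ≤ (K.index : ℝ) ^ (2 : ℝ) * Fintype.card G := hN
      _ ≤ (V : ℝ) ^ ((16 : ℝ) / 54) * (V : ℝ) ^ (((2 : ℝ) + 1 / 18) / 3) :=
          mul_le_mul hidx2 hcard (by positivity) (by positivity)
      _ = (V : ℝ) ^ ((53 : ℝ) / 54) := by
          rw [← Real.rpow_add hVpos]; norm_num
  have hlt : (V : ℝ) ^ ((53 : ℝ) / 54) < (V : ℝ) ^ (1 : ℝ) :=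
    Real.rpow_lt_rpow_of_exponent_lt hV1 (by norm_num)
  rw [Real.rpow_one] at hlt
  exact absurd (hchain.trans_lt hlt) (lt_irrefl _)

end CNonabelianTPPFamilies.Negative

end Summit.MatrixMultiplication.MatrixMultiplication.Theorems

end
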